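import Summits.Ventures.DiscreteObjects.Hadamard.Order666Excluded668
import Summits.Ventures.DiscreteObjects.Hadamard.AutStructureSummary668C

/-!
# H(668): an element order divisible by 333 IS 333 (kernel) — the order-333 line is exactly the LP(333) shift

Framing: lottery ticket; floor = certified bounds/negative ranges.

Cell pub-namedobj (venture DiscreteObjects), target (H), hadamard gen 19.  Packaging of the census exclusions around `333 = 9·37`:
for a signed automorphism `(π, κ, d, e)` of a Hadamard matrix of order `668` with `333 ∣ N`, `N = orderOf (π, κ)`, write
`N = 333·m`; every prime `r ∣ m` is impossible — `r = 2`: `666 ∣ N` (gen 19, `Order666Excluded668`); `r = 3`: `999 = 27·37 ∣ N`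
(gen 18, `27·q ∤`); `r = 5, 7, 11`: `185, 259, 407 ∣ N` (gen 11, small × large pairs `(5,37), (7,37), (11,37)`); `r = 37`:
`37² ∣ N` (gen 16/18, `p² ∤` for `p ≥ 7`); `r ∈ {13, 23, 41, 83, 167}`: two distinct primes `≥ 13` (gen 11); any other prime is
outside the spectrum `{2,3,5,7,11,13,23,37,41,83,167}` (gen 9).  Hence **`hadamard668_orderOf_eq_333_of_dvd`: `333 ∣ N ⇒ N = 333`**,
and with `Order333LegendrePair668`: *the signed automorphisms of a putative H(668) whose order is divisible by `333` are exactly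
elements of order `333`, and one exists iff a Legendre pair of length `333` exists.*  No new mathematics beyond the cited files;
H(668) untouched.  Ours; no `sorry`.
-/

namespace Summit.Ventures.DiscreteObjects.Hadamard

open Finset BigOperators Matrix

open Literature.Combinatorics.Designs.GoethalsSeidel (IsHadamardMatrix)

variable {ι : Type*} [Fintype ι] [DecidableEq ι]

/-- **`333 ∣ orderOf (π, κ) ⇒ orderOf (π, κ) = 333`** for every signed automorphism of a Hadamard matrix of order `668`. -/
theorem hadamard668_orderOf_eq_333_of_dvd {H : Matrix ι ι ℤ} (hH : IsHadamardMatrix H) (hι : Fintype.card ι = 668)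
    (π κ : Equiv.Perm ι) (d e : ι → ℤ) (haut : IsSignedAut H π κ d e)
    (h333 : 333 ∣ orderOf ((π, κ) : Equiv.Perm ι × Equiv.Perm ι)) :
    orderOf ((π, κ) : Equiv.Perm ι × Equiv.Perm ι) = 333 := by
  set N := orderOf ((π, κ) : Equiv.Perm ι × Equiv.Perm ι) with hN
  have hN0 : N ≠ 0 := (orderOf_pos _).ne'
  obtain ⟨m, hm⟩ := h333
  by_contra hne
  have hm1 : m ≠ 1 := fun h => hne (by rw [hm, h])
  obtain ⟨r, hr, hrm⟩ := Nat.exists_prime_and_dvd hm1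
  have h333r : 333 * r ∣ N := by rw [hm]; exact Nat.mul_dvd_mul_left 333 hrm
  have hrN : r ∣ N := dvd_trans (dvd_mul_left r 333) h333r
  have hmem := hadamard668_signedAut_prime_dvd_orderOf hH hι π κ d e haut hr hrN
  obtain ⟨-, -, -, -, -, h27, -, -⟩ := hadamard668_aut_cyclic_exclusions hH hι π κ d e haut
  have hsl := fun p q h hd => no_hadamard668_signedAut_order_small_large hH hι π κ d e haut (p := p) (q := q) h hd
  have htp := fun p q hp hq hpq hp13 hq13 hd =>
    no_hadamard668_signedAut_order_two_primes_ge_13 hH hι π κ d e haut (p := p) (q := q) hp hq hpq hp13 hq13 hd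
  simp only [Finset.mem_insert, Finset.mem_singleton] at hmem
  rcases hmem with rfl | rfl | rfl | rfl | rfl | rfl | rfl | rfl | rfl | rfl | rfl
  · exact hadamard668_signedAut_not_dvd_orderOf_666 hH hι π κ d e haut (by simpa using h333r)
  · exact h27 37 (by norm_num) (dvd_trans ⟨1, by norm_num⟩ h333r)
  · exact hsl 5 37 (by simp) (dvd_trans ⟨9, by norm_num⟩ h333r)
  · exact hsl 7 37 (by simp) (dvd_trans ⟨9, by norm_num⟩ h333r)
  · exact hsl 11 37 (by simp) (dvd_trans ⟨9, by norm_num⟩ h333r)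
  · exact htp 13 37 (by norm_num) (by norm_num) (by norm_num) (by norm_num) (by norm_num) (dvd_trans ⟨9, by norm_num⟩ h333r)
  · exact htp 23 37 (by norm_num) (by norm_num) (by norm_num) (by norm_num) (by norm_num) (dvd_trans ⟨9, by norm_num⟩ h333r)
  · exact hadamard668_signedAut_not_dvd_orderOf_sq_ge7 hH hι π κ d e haut (p := 37) (by norm_num) (by norm_num)
      (dvd_trans ⟨9, by norm_num⟩ h333r)
  · exact htp 37 41 (by norm_num) (by norm_num) (by norm_num) (by norm_num) (by norm_num) (dvd_trans ⟨9, by norm_num⟩ h333r)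
  · exact htp 37 83 (by norm_num) (by norm_num) (by norm_num) (by norm_num) (by norm_num) (dvd_trans ⟨9, by norm_num⟩ h333r)
  · exact htp 37 167 (by norm_num) (by norm_num) (by norm_num) (by norm_num) (by norm_num) (dvd_trans ⟨9, by norm_num⟩ h333r)

end Summit.Ventures.DiscreteObjects.Hadamard
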